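import Mathlib

/-!
# stub_cmLambdaLower · k4 · g8 — kernel sketch (stub-ideation, technique family 3: assume-the-opposite)

Helper lemmas for the idea card `Ideas/stub_cmLambdaLower-k4.md` (slug `stub-cmlambdalower-k4-g8`).
Nothing here proves BSD, `ResidualSignedLambdaLowerCMAtTwo` (item 22608) or
`ResidualThetaCountLowerPureAtTwo` (item 26074); both stay OPEN.

* §A  bad-prime vacuity (Plan 1): coinvariant / norm-tower algebra + `decide` certificates for the
       361a1 @ 19 small case (inertia acting through `ℤ/4` by the rotation `(a,b) ↦ (-b,a)`).
* §B  U19 pre-run (Plan 2): the value clause `(i_D)` is inhabited by `z := Lm • z₀`; the cyclic piece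
       `Λ z₀ / Λ (f • z₀) ≅ Λ/(f)` and the quotient tower behind `λ(H/Λ f z₀) = λ(H/Λ z₀) + λ(Λ/f)`.
* §C  kit-free census certificates (Plan 3): the 2-division cubics of 19a1 and 361a1 both have a root in
       `ℚ(γ)`, `γ³ - 2γ - 2 = 0`; `a₂(19a1) = a₂(361a1) = 0`, `a₂(49a1) = 1`; habitat filter `q ≡ 3 (mod 8)`.
-/

namespace Summit.BirchSwinnertonDyer.BirchSwinnertonDyer.Cruxes.ResidualThetaCountLowerPureAtTwo.StubIdeasK4G8

/-! ## §A  Bad-prime vacuity: the algebra behind `H¹(I_w, A_ρ) = A_ρ/(σ-1)A_ρ = 0` and `lim← = 0` -/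

/-- A1. If `σ - id` is onto (e.g. `σ - 1` invertible on `V`, hence onto the divisible `A = V/T`),
the module of coinvariants `A ⧸ (σ - id)(A)` is zero. -/
theorem coinvariants_eq_zero {A : Type*} [AddCommGroup A] (σ : A →+ A)
    (h : Function.Surjective (σ - AddMonoidHom.id A)) (x : A ⧸ (σ - AddMonoidHom.id A).range) :
    x = 0 := by
  induction x using QuotientAddGroup.induction_on with
  | H a =>
    obtain ⟨b, hb⟩ := h a
    exact (QuotientAddGroup.eq_zero_iff a).mpr ⟨b, hb⟩

/-- A2. Norm-tower lemma: an inverse system of `2^a`-torsion groups whose transition maps are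
multiplication by `2` (the stabilised norms `1 + F^{2^n} = 2` on `A^{I_w}`) has zero limit:
every compatible sequence vanishes. This is `H¹_Iw(ℚ_w, T_ρ) = 0` at an additive prime `w`. -/
theorem eq_zero_of_two_nsmul_tower {B : Type*} [AddCommGroup B] (a : ℕ)
    (hB : ∀ b : B, 2 ^ a • b = 0) (s : ℕ → B) (hs : ∀ n, s n = 2 • s (n + 1)) (n : ℕ) :
    s n = 0 := by
  have key : ∀ m n, s n = 2 ^ m • s (n + m) := by
    intro m
    induction m with
    | zero => intro n; simp
    | succ m ih =>
      intro n
      rw [ih n, hs (n + m), smul_smul, ← pow_succ, Nat.add_assoc]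
  rw [key a n, hB]

/-- The rotation `(a, b) ↦ (-b, a)`: multiplication by `i` on `ℤ[i]/2^k` in the basis `1, i`
(the inertia generator at `19` on `361a1[2^k]`, `Φ₁₉ ≅ ℤ/4`). -/
def rot {R : Type*} [CommRing R] (v : Fin 2 → R) : Fin 2 → R := ![-(v 1), v 0]

/-- A3. `A[4]^{σ} ≅ ℤ/2`: exactly two fixed vectors of the rotation on `(ℤ/4)²`. -/
theorem card_fixed_rot_zmod4 :
    (Finset.univ.filter (fun v : Fin 2 → ZMod 4 => rot v = v)).card = 2 := by decide

/-- A3'. Same count on `(ℤ/8)²`: the fixed module is `ℤ/2` at every level (`A^{I_19} = ℤ/2`). -/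
theorem card_fixed_rot_zmod8 :
    (Finset.univ.filter (fun v : Fin 2 → ZMod 8 => rot v = v)).card = 2 := by decide

/-- A4. At FINITE coefficient level the ramified `H¹(I, A[4]) = A[4]/(σ-1)` is `ℤ/2 ≠ 0`
(the image of `σ - 1` has index `2` in the `16`-element group) … -/
theorem card_image_rot_sub_id_zmod4 :
    (Finset.univ.image (fun v : Fin 2 → ZMod 4 => rot v - v)).card = 8 := by decide

/-- A4'. … but every such class dies in `A[8]/(σ-1)`: the inclusion `A[4] ↪ A[8]` (coordinates
`v ↦ 2v`) lands inside the image of `σ - 1` on `(ℤ/8)²`.  Hence `lim→ A[2^k]/(σ-1) = A/(σ-1)A = 0`,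
i.e. `H¹(I_19, A_{361a1}) = 0`: no ramified classes over `ℚ_{∞,w}` with divisible coefficients. -/
theorem image_zmod4_killed_in_zmod8 :
    ∀ v : Fin 2 → ZMod 4, ∃ w : Fin 2 → ZMod 8,
      rot w - w = ![((2 * (v 0).val : ℕ) : ZMod 8), ((2 * (v 1).val : ℕ) : ZMod 8)] := by
  decide

/-! ## §B  U19 pre-run: the value clause is algebraically inhabited; the cyclic piece -/

/-- B1. The junk witness `z := Lm • z₀` inhabits the value clause `(i_D)` with `D := 𝒸 z₀`, `c := 1`,
for ANY `z₀`; and `D ≠ 0` as soon as `𝒸 z₀ ≠ 0` (= the `(nz)` clause). No zeta-value formula is used. -/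
theorem valueClause_inhabited {Λ H : Type*} [CommRing Λ] [AddCommGroup H] [Module Λ H]
    (𝒸 : H →ₗ[Λ] Λ) (Lm : Λ) (z₀ : H) :
    ∃ D c : Λ, 𝒸 (Lm • z₀) = c * D * Lm ∧ (𝒸 z₀ ≠ 0 → D ≠ 0) ∧ c = 1 :=
  ⟨𝒸 z₀, 1, by rw [map_smul, smul_eq_mul]; ring, id, rfl⟩

/-- B2. For a torsion-free vector `z₀`, the annihilator of the class of `z₀` in `M ⧸ Λ(f • z₀)` is
exactly `(f)`. -/
theorem torsionOf_mkQ_eq_span {R M : Type*} [CommRing R] [AddCommGroup M] [Module R M]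
    (z₀ : M) (f : R) (htf : ∀ r : R, r • z₀ = 0 → r = 0) :
    Ideal.torsionOf R (M ⧸ (R ∙ (f • z₀))) ((R ∙ (f • z₀)).mkQ z₀) = Ideal.span {f} := by
  ext r
  rw [Ideal.mem_torsionOf_iff, Ideal.mem_span_singleton', ← map_smul, Submodule.mkQ_apply,
    Submodule.Quotient.mk_eq_zero, Submodule.mem_span_singleton]
  constructor
  · rintro ⟨s, hs⟩
    refine ⟨s, sub_eq_zero.mp (htf _ ?_)⟩
    rw [sub_smul, mul_smul, hs, sub_self]
  · rintro ⟨a, rfl⟩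
    exact ⟨a, by rw [mul_smul]⟩

/-- B3. The cyclic piece `Λ z̄₀ ⊂ M ⧸ Λ(f • z₀)` is `Λ/(f)`: this is the summand `λ(Λ/f) = normλ f`
in `λ(H/Λ f z₀) = λ(H/Λ z₀) + λ(Λ/f)` (applied with `f := Lm`, resp. `f := D`). -/
noncomputable def spanMkQEquivQuot {R M : Type*} [CommRing R] [AddCommGroup M] [Module R M]
    (z₀ : M) (f : R) (htf : ∀ r : R, r • z₀ = 0 → r = 0) :
    (R ∙ ((R ∙ (f • z₀)).mkQ z₀)) ≃ₗ[R] R ⧸ Ideal.span {f} :=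
  (Ideal.quotTorsionOfEquivSpanSingleton R (M ⧸ (R ∙ (f • z₀))) ((R ∙ (f • z₀)).mkQ z₀)).symm
    ≪≫ₗ Submodule.quotEquivOfEq _ _ (torsionOf_mkQ_eq_span z₀ f htf)

/-- B4. The cyclic piece is the image of `Λ z₀`. -/
theorem map_mkQ_span {R M : Type*} [CommRing R] [AddCommGroup M] [Module R M] (z₀ : M) (f : R) :
    (R ∙ z₀).map (R ∙ (f • z₀)).mkQ = R ∙ ((R ∙ (f • z₀)).mkQ z₀) := by
  rw [Submodule.map_span, Set.image_singleton]

/-- B5. The quotient tower: `(M ⧸ Λ f z₀) ⧸ (Λ z₀) ≅ M ⧸ Λ z₀`. With B3/B4 and exactness of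
`K ⊗_𝒪 -` this gives `λ_K(M/Λ f z₀) = λ_K(M/Λ z₀) + λ_K(Λ/f)`. -/
noncomputable def quotQuotEquiv {R M : Type*} [CommRing R] [AddCommGroup M] [Module R M]
    (z₀ : M) (f : R) :
    ((M ⧸ (R ∙ (f • z₀))) ⧸ (R ∙ z₀).map (R ∙ (f • z₀)).mkQ) ≃ₗ[R] M ⧸ (R ∙ z₀) :=
  Submodule.quotientQuotientEquivQuotient _ _
    ((Submodule.span_singleton_le_iff_mem _ _).mpr
      (Submodule.smul_mem _ f (Submodule.mem_span_singleton_self z₀)))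

/-! ## §C  Kit-free census certificates -/

/-- C1. The 2-division cubic `4x³ + 4x² - 36x - 59` of `19a1 = [0,1,1,-9,-15]` has the root
`(-2 + 3γ + γ²)/2` in `ℚ(γ)`, `γ³ = 2γ + 2`. -/
theorem twoDivision_19a1_root (g : ℚ) (hg : g ^ 3 - 2 * g - 2 = 0) :
    4 * ((-2 + 3 * g + g ^ 2) / 2) ^ 3 + 4 * ((-2 + 3 * g + g ^ 2) / 2) ^ 2
      - 36 * ((-2 + 3 * g + g ^ 2) / 2) - 59 = 0 := by
  linear_combination ((1 / 2) * g ^ 3 + (9 / 2) * g ^ 2 + (25 / 2) * g + 23 / 2) * hg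

/-- C2. The 2-division cubic `4x³ - 152x + 361` of `361a1 = [0,0,1,-38,90]` has the root
`(4 - 5γ - 3γ²)/2` in the SAME field `ℚ(γ)`.  (Both cubics are irreducible — no rational 2-torsion —
and `x³ - 2x - 2` is Eisenstein at `2`; so `ℚ(19a1[2]) = ℚ(361a1[2])` = the `S₃`-closure of `ℚ(γ)`,
`19a1[2] ≅ 361a1[2]`, and `a_ℓ(19a1) ≡ a_ℓ(361a1) (mod 2)` for every `ℓ ∤ 2·19`.) -/
theorem twoDivision_361a1_root (g : ℚ) (hg : g ^ 3 - 2 * g - 2 = 0) :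
    4 * ((4 - 5 * g - 3 * g ^ 2) / 2) ^ 3 - 152 * ((4 - 5 * g - 3 * g ^ 2) / 2) + 361 = 0 := by
  linear_combination (-(27 / 2) * g ^ 3 - (135 / 2) * g ^ 2 - (171 / 2) * g - 89 / 2) * hg

/-- C3. `#E(𝔽₂)` affine counts: `19a1` and `361a1` have `2` affine points (`#E(𝔽₂) = 3`, `a₂ = 0`:
supersingular with `a₂ = 0`, on-habitat), `49a1 = [1,-1,0,-2,-1]` has `1` (`#E(𝔽₂) = 2`, `a₂ = 1`:
ordinary — OFF the `a₂ = 0` habitat; `2` splits in `ℚ(√-7)`). -/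
theorem affine_counts_mod_two :
    (Finset.univ.filter (fun p : ZMod 2 × ZMod 2 =>
        p.2 ^ 2 + p.2 = p.1 ^ 3 + p.1 ^ 2 - 9 * p.1 - 15)).card = 2 ∧
    (Finset.univ.filter (fun p : ZMod 2 × ZMod 2 =>
        p.2 ^ 2 + p.2 = p.1 ^ 3 - 38 * p.1 + 90)).card = 2 ∧
    (Finset.univ.filter (fun p : ZMod 2 × ZMod 2 =>
        p.2 ^ 2 + p.1 * p.2 = p.1 ^ 3 - p.1 ^ 2 - 2 * p.1 - 1)).card = 1 := by
  refine ⟨by decide, by decide, by decide⟩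

/-- C4. Habitat filter for Gross-type CM partners `A(q)`, `K = ℚ(√-q)`: `2` inert in `K`
(`⇔ -q ≡ 5 (mod 8) ⇔ q ≡ 3 (mod 8)`, needed for `a₂(g) = 0`) holds for `q = 11, 19, 43, 67, 163`
and fails for `q = 7` (`49a1`). -/
theorem habitat_filter_mod_eight :
    11 % 8 = 3 ∧ 19 % 8 = 3 ∧ 43 % 8 = 3 ∧ 67 % 8 = 3 ∧ 163 % 8 = 3 ∧ 7 % 8 ≠ 3 := by decide

end Summit.BirchSwinnertonDyer.BirchSwinnertonDyer.Cruxes.ResidualThetaCountLowerPureAtTwo.StubIdeasK4G8
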